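import Summits.BirchSwinnertonDyer.Rank1Residual.X4.KolyvaginIndexRecordsKitOddPrime
import HarnessLib

/-!
# BSD rank-≤1 residual cell, lane class X11b (`p ∥ N`: MULTIPLICATIVE at a prime `p ≥ 5`, `ρ̄_{E,p}` irreducible),
rank ONE: `BSD(E,p)` PER PAIR from
# PUBLISHED theorems + Kolyvagin's HEEGNER-INDEX certificate (two engines), `ρ̄_{E,p}` onto IN THE KERNEL — records 44

HONEST FRAMING (cell `b2b-bsdres-*`, verbatim): prove what is provable now; shrink each hard class to its core with
data; no claim beyond stated classes; COMBINATION classes deleted from PUBLISHED theorems only, CONSTRUCTION-shaped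
remainder typed; this is not "finishing BSD". X11b stays CONSTRUCTION-SHAPED; everything here is PER PAIR; no lane
verdict is changed; no named fact is introduced (debt 0); nothing is booked by this unit (the rung-K2 owner
bsd-stepL, the x11b
lineage that holds row B9's E1/K2 claim, census-lead, the Kurihara lane and referee A decide what a record is
worth); Cremona's numbers
(`r_an = 1`, `#Ш_an`, models, generators, `∏ c_ℓ`, torsion, optimality / Manin codes, the galrep datum) are INPUTS.

Unit `b2b-bsdres-x11c`, GEN 32 (prover-b2b-bsdres-x11c-g32-0) — the «X11 beyond 3» half of the unit's D-0075 purpose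
(«GRH-free
Kolyvagin–Heegner-index certificates X4 r1 p ≥ 7, X11 beyond 3»): the cell's certificate engines turned on lane
class X11b as GEN 27–31 turned
them on X7 (`Supersingular/KolyvaginIndexRecordsX7RankOne01–432`). POPULATION
(`HOME/b2b-bsdres-x11c/gen32/pop/build_harvest_x11b.py` = gen 27's
class-agnostic census restricted to X11b with a per-(label, p) record test): the rank-ONE classes (Cremona curve 1,
non-CM) whose cell
`(p, X11b)` — `p ≥ 5`, `p ∥ N` — is OPEN on the Kurihara lane's residue of record (bsdN sweep v4u `RESIDUE.jsonl` ×
v5u verdict `residue`; on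
848 of them the lane's own tail is T-KOLY, whose single certified Heegner field excludes the primes dividing
`m·D_K`) and which are
certificate-shaped on Cremona's data — no galrep code at `p` (`ρ̄_{E,p}` onto), `p ∤ #E(ℚ)_tors·∏ c_ℓ` (so
`p ∤ c_p = ord_p Δ` at a split
`p`), `p ∤ #Ш_an` — and carry no Kolyvagin-index record `bsdp_k<label>_<p>`: 927 pairs on 869 classes (`p = 5`: 605,
`7`: 221, `11`: 41,
`13`: 20, `17 ≤ p ≤ 103`: 40; split 411 / non-split 516; 268 semistable; `1.6·10⁴ < N < 5·10⁵`). 920 of them ALSO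
carry the unit's GEN 10
beyond-window DATA record (`X11b/BeyondWindowRecordsNN`: Skinner 2016 Thm. A ∘ Stein–Wuthrich 2013 `p`-adic road,
binders as displayed there)
— for those this file is a SECOND, GRH-free and main-conjecture-free road; 7 carry no per-pair record. Not in reach
of this route (numbers, not
a verdict): the lane's 3 062 Tamagawa-obstructed X11b rank-one cells at `p ≥ 5` (`p ∣ c_q` for some `q`; Jetchev
2008's Hypothesis (∗)
`p ∤ N` fails at `p ∥ N`). THIS FILE (records 44): 10 pairs — `430920d1@5`, `432630bo1@5`, `432630u1@5`,
`433160h1@5`, `433290x1@5`, `434070ds1@5`, `436170bh1@5`, `436590ea1@5`, `436590ex1@5`, `438960bd1@5`. 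

THE ROUTE (the unit's GEN 26/27 Kolyvagin route, class-agnostic): Kolyvagin's theorem as PRINTED by McCallum (LMS LN
153 (1991) §1, p. 296) /
Gross (ibid., Prop. 2.1 (2)) — tree named facts `kolyvagin`, `Kolyvagin1990_padicValNat_card_sha_le`, whose printed
hypotheses are `y_K` of
infinite order, `p` odd, `ρ̄_{E,p}` onto, and NOTHING about the reduction of `E` at `p` (at `p ∥ N` the Heegner
hypothesis — every prime of
`N` split in `K` — makes `p` split in `K`; nothing more is asked) —: `ord_p #Ш(E/K) ≤ 2·ord_p [E(K):ℤy_K]`; so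
`p ∤ [E(K):ℤy_K]` gives
`Ш(E/K)[p] = 0`, hence `Ш(E/ℚ)[p] = 0`, and with `ord_p #Ш_an = 0` Miller's `BSD(E,p)` — the tree's class-agnostic
consumer
`Typed.bsdp_of_kolyvagin_of_not_dvd_index` (`Literature/…/Rank1Residual/Typed/KolyvaginCertificate.lean`).

THE CERTIFICATE (per pair; the cell's EXISTING engines run VERBATIM — no private engine, no knob; ONE batched kit
job per stage with an
in-job fan-out wrapper): engine 1 = gen 3's `engine1_cha1b/main.py` = x9-g7 `jobD1b.py` (cypari2, sha256
`69e29ec7…`; rank-one mode: Heegner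
fields `K = ℚ(√D)`, `D < -4` fundamental, every prime of `N` split, `p ∤ D`, increasing `|D| ≤ 6000`, `≤ 30` fields;
root number of `E^D`
`+1`, rank-`≥ 2` twists skipped; `hy = L'(E,1)·L(E^D,1)·√|D|/(4·Area(E))`, `ρ = hy/ĥ(x)`, `m = √(4ρ)` an integer,
CERT iff `p ∤ m` —
Miller 2011 Thm. 4.1 / Cor. 4.8); engine 2 = gen 3's `engine2/run_cert.py` (`1b54bb20…`) + `e2lib.py` (`6701e05d…`)
+ `tate_stdlib.py`
(`ed9e5fd9…`) (stdlib python: independent `L`-series, AGM periods, Tate heights; `m`, `ord_p m` must be EQUAL;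
discrete checks — model,
conductor, Tamagawa, non-CM, irreducibility / saturation / `E(K)[p] = 0` witnesses, `D` Heegner); twist values =
additive-p1's
`twistvals/main.py` (`e501b988…`). Kit jobs: j259809, j260567, j260660, j260662, j260664, j260666, j260667, j260960,
j260961. Evidence: `HOME/b2b-bsdres-x11c/gen32/` (`KOLY-X11BR1-TABLE.md`, outputs, inputs,
SHA256SUMS); REPORT.md §41.

KERNEL (per pair, through the unit's kit theorem `X4.bsdp_prime_of_kolyvaginIndex_of_serreCounts` of
`X4/KolyvaginIndexRecordsKitOddPrime.lean` — class-agnostic despite its namespace —, every numeric hypothesis a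
`decide` goal): `Δ ≠ 0`;
global minimality of Cremona's model (bounded Kraus criterion); `ρ̄_{E,p}` ONTO by Serre's Prop. 19 from three
witness primes
`(ℓ₁, ℓ₂, ℓ₃)` (types s₁ split / s₂ non-split / s₃ `u = a²/ℓ ∉ {0,1,2,4}`, `u² − 3u + 1 ≢ 0`) whose point counts
`#Ẽ(𝔽_ℓ)` (schema
`countPoints`) are evaluated in the kernel. BINDERS (displayed in every theorem): `hGZK` (Gross–Zagier–Kolyvagin),
`hKo` / `hB` (Kolyvagin
as printed), the Heegner datum (`K`, level `N`, `P`, `p ∤ [E(K):ℤP]`), `r_an ≤ 1`, `#Ш_an = q` with `ord_p q = 0`.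
NOT rechecked in the
kernel (engine work): `L'(E,1)`, `L(E^D,1)`, periods, heights, saturation, the integrality of `4ρ`; nor the lane's
class bit (`p ∥ N`,
split / non-split — bookkeeping only, the route does not use it). What a record is worth is the owners' / lane's /
referee's call
(EVIDENCE-grade certificate under displayed binders, as every Heegner-index record of the cell).

References: McCallum 1991 §1 [McCallumLMS1991]; Gross 1991 Prop. 2.1 [GrossLMS1991]; Kolyvagin 1990
[KolyvaginEulerSystems1990]; Serre 1972 §2.8 Prop. 19 [Serre1972]; Miller 2011 Def. 1.1, Thm. 4.1, Cor. 4.8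
[Miller2011LMS];
Silverman AEC VII.1, VIII.8 [SilvermanAEC2009]; Cremona's tables [Cremona2006].
-/

set_option autoImplicit false

noncomputable section

open scoped Classical

open WeierstrassCurve Literature.NumberTheory.EllipticCurves
  Literature.NumberTheory.EllipticCurves.Rank1Residual
  Literature.NumberTheory.EllipticCurves.Rank1Residual.Typed
  Literature.NumberTheory.EllipticCurves.Rank1Residual.X11RankOneCertificates
  Summit.BirchSwinnertonDyer.BirchSwinnertonDyer.Rank1Residual.IntModel
  Summit.BirchSwinnertonDyer.BirchSwinnertonDyer.Rank1Residual.X11RankOne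
  Summit.BirchSwinnertonDyer.Rank1Residual.X4

namespace Summit.BirchSwinnertonDyer.Rank1Residual.X11b

/-- **`BSD(E,5)` for `430920d1`** (`N = 430920 = 2³·3⁴·5·7·19`; NON-SPLIT MULTIPLICATIVE at `5` (Kodaira `I1`, `c_5 = 1`, additive at `2`, `3`);
`#tors = 1`, `∏c = 4`, `r_an = 1`, `#Ш_an = 1`, generator `(-92, 1475)`; lane residue cell `(5, X11b)` (bsdN v4u/v5u of record: `residue:X11b`, lane
tail T-KOLY); ALSO the unit's GEN 10 beyond-window DATA record in `X11b/BeyondWindowRecords58.lean` (Skinner 2016 Thm. A ∘ Stein–Wuthrich 2013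
`p`-adic road, binders as displayed there) — this row is a SECOND road). `D = -1319` (1319 prime): **`m = [E(K):ℤy_K] = 8`, `5 ∤ m`** (`ρ = 15.99…`;
`L'(E,1) = 6.12629252…`, `L(E^D,1) = 0.04372844…`, `ĥ(x) = 5.25132965…`) — engine 1 (j259809) = engine 2 (j260664; EQUAL, dev. ≤ 7.5·10⁻¹⁵, checks
true); twist `E^D` (j260667): `#tors·∏c·#Ш_an = 1·8·1`, prime to `5` — BSD-consistent. Witnesses mod `5` `(ℓ,#Ẽ(𝔽_ℓ))` = `(13,13)` (`a = 1`,
`a² − 4ℓ ≡ 4` square), `(17,17)` (`a = 1`, `a² − 4ℓ ≡ 3` non-square), `(17,17)` (`u ≡ 3`).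
[cite: McCallumLMS1991, §1 Theorem (Kolyvagin), p. 296] [cite: Serre1972, §2.8 Prop. 19] [cite: Cremona2006, Table 1 (label 430920d1)] -/
theorem bsdp_k430920d1_5 (hGZK : rank_eq_analyticRank_of_analyticRank_le_one) (W : WeierstrassCurve ℚ)
    (hW : W = ⟨0, 0, 0, 24462, 5204817⟩) {N : ℕ} [NeZero N] {K : Type} [Field K] [NumberField K]
    (hKo : kolyvagin N W K) (hB : Kolyvagin1990_padicValNat_card_sha_le N W K) (hK : IsImaginaryQuadratic K)
    (hH : SatisfiesHeegnerHypothesis N K) {P : (W.baseChange K).toAffine.Point} (hP : IsHeegnerPoint N W K P)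
    (hnt : ¬ IsOfFinAddOrder P) (hI : ¬ 5 ∣ (AddSubgroup.zmultiples P).index) (hr : W.analyticRank ≤ 1)
    {q : ℚ} (hq : shaAn W = (q : ℂ)) (hv : padicValRat 5 q = 0) : BSDp W 5 :=
  bsdp_prime_of_kolyvaginIndex_of_serreCounts 5 (by norm_num) (by norm_num) 0 0 0 24462 5204817 (by decide +kernel)
    (by decide +kernel) (by decide +kernel) 13 17 17 (by norm_num) (by norm_num) (by norm_num) (by norm_num)
    (by norm_num) (by norm_num) (by norm_num) (by norm_num) (by norm_num) (by decide +kernel) (by decide +kernel)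
    (by decide +kernel) (n₁ := 13) (n₂ := 17) (n₃ := 17) (hc₁ := by decide +kernel) (hc₂ := by decide +kernel)
    (hc₃ := by decide +kernel) (by decide +kernel) (by decide +kernel) (by decide +kernel) hGZK W
    (by rw [hW]; norm_num) hKo hB hK hH hP hnt hI hr hq hv

/-- **`BSD(E,5)` for `432630bo1`** (`N = 432630 = 2·3²·5·11·19·23`; SPLIT MULTIPLICATIVE at `5` (Kodaira `I3`, `c_5 = 3`, additive at `3`); `#tors = 1`,
`∏c = 6`, `r_an = 1`, `#Ш_an = 1`, generator `(973099/49, 96351256/343)`; lane residue cell `(5, X11b)` (bsdN v4u/v5u of record: `residue:X11b,X4`,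
lane tail T-KOLY, other open cells `(3, X4)`); ALSO the unit's GEN 10 beyond-window DATA record in `X11b/BeyondWindowRecords58.lean` (Skinner 2016
Thm. A ∘ Stein–Wuthrich 2013 `p`-adic road, binders as displayed there) — this row is a SECOND road). `D = -1799` (1799 = 7·257):
**`m = [E(K):ℤy_K] = 168`, `5 ∤ m`** (`ρ = 7056.00…`; `L'(E,1) = 5.14819562…`, `L(E^D,1) = 0.69360852…`, `ĥ(x) = 9.50430704…`) — engine 1 (j259809)
= engine 2 (j260666; EQUAL, dev. ≤ 1.1·10⁻¹³, checks true); twist `E^D` (j260667): `#tors·∏c·#Ш_an = 1·24·49`, prime to `5` — BSD-consistent.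
Witnesses mod `5` `(ℓ,#Ẽ(𝔽_ℓ))` = `(13,15)` (`a = -1`, `a² − 4ℓ ≡ 4` square), `(29,27)` (`a = 3`, `a² − 4ℓ ≡ 3` non-square), `(37,29)` (`u ≡ 3`).
[cite: McCallumLMS1991, §1 Theorem (Kolyvagin), p. 296] [cite: Serre1972, §2.8 Prop. 19] [cite: Cremona2006, Table 1 (label 432630bo1)] -/
theorem bsdp_k432630bo1_5 (hGZK : rank_eq_analyticRank_of_analyticRank_le_one) (W : WeierstrassCurve ℚ)
    (hW : W = ⟨1, -1, 0, -1326500754, 18595893791060⟩) {N : ℕ} [NeZero N] {K : Type} [Field K] [NumberField K]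
    (hKo : kolyvagin N W K) (hB : Kolyvagin1990_padicValNat_card_sha_le N W K) (hK : IsImaginaryQuadratic K)
    (hH : SatisfiesHeegnerHypothesis N K) {P : (W.baseChange K).toAffine.Point} (hP : IsHeegnerPoint N W K P)
    (hnt : ¬ IsOfFinAddOrder P) (hI : ¬ 5 ∣ (AddSubgroup.zmultiples P).index) (hr : W.analyticRank ≤ 1)
    {q : ℚ} (hq : shaAn W = (q : ℂ)) (hv : padicValRat 5 q = 0) : BSDp W 5 :=
  bsdp_prime_of_kolyvaginIndex_of_serreCounts 5 (by norm_num) (by norm_num) 1 (-1) 0 (-1326500754) 18595893791060 (by decide +kernel)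
    (by decide +kernel) (by decide +kernel) 13 29 37 (by norm_num) (by norm_num) (by norm_num) (by norm_num)
    (by norm_num) (by norm_num) (by norm_num) (by norm_num) (by norm_num) (by decide +kernel) (by decide +kernel)
    (by decide +kernel) (n₁ := 15) (n₂ := 27) (n₃ := 29) (hc₁ := by decide +kernel) (hc₂ := by decide +kernel)
    (hc₃ := by decide +kernel) (by decide +kernel) (by decide +kernel) (by decide +kernel) hGZK W
    (by rw [hW]; norm_num) hKo hB hK hH hP hnt hI hr hq hv

/-- **`BSD(E,5)` for `432630u1`** (`N = 432630 = 2·3²·5·11·19·23`; SPLIT MULTIPLICATIVE at `5` (Kodaira `I6`, `c_5 = 6`, additive at `3`); `#tors = 6`,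
`∏c = 144`, `r_an = 1`, `#Ш_an = 1`, generator `(3027, -1101)`; lane residue cell `(5, X11b)` (bsdN v4u/v5u of record: `residue:X11b,X3`, lane tail
T-KOLY, other open cells `(3, X3)`); ALSO the unit's GEN 10 beyond-window DATA record in `X11b/BeyondWindowRecords58.lean` (Skinner 2016 Thm. A ∘
Stein–Wuthrich 2013 `p`-adic road, binders as displayed there) — this row is a SECOND road). `D = -2351` (2351 prime): **`m = [E(K):ℤy_K] = 192`,
`5 ∤ m`** (`ρ = 9215.99…`; `L'(E,1) = 2.38405431…`, `L(E^D,1) = 3.13455229…`, `ĥ(x) = 2.85106671…`) — engine 1 (j259809) = engine 2 (j260666; EQUAL,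
dev. ≤ 1.4·10⁻¹³, checks true); twist `E^D` (j260667): `#tors·∏c·#Ш_an = 2·288·64`, prime to `5` — BSD-consistent. Witnesses mod `5` `(ℓ,#Ẽ(𝔽_ℓ))` =
`(13,18)` (`a = -4`, `a² − 4ℓ ≡ 4` square), `(7,12)` (`a = -4`, `a² − 4ℓ ≡ 3` non-square), `(7,12)` (`u ≡ 3`). FLAG `opt-code-2`: Cremona's
optimality code `2` (curve 1 is one of 2 possibly optimal curves of its class; Manin constant `1` conditional on it); the engines' normalisation
assumes the optimal curve with Manin constant `1` — `ρ̄_{E,5}` onto forbids a `5`-isogeny in the class, so `ord₅` of the Heegner index is the same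
for every curve of the class and the reading stands if the optimal curve's Manin constant is prime to `5`.
[cite: McCallumLMS1991, §1 Theorem (Kolyvagin), p. 296] [cite: Serre1972, §2.8 Prop. 19] [cite: Cremona2006, Table 1 (label 432630u1)] -/
theorem bsdp_k432630u1_5 (hGZK : rank_eq_analyticRank_of_analyticRank_le_one) (W : WeierstrassCurve ℚ)
    (hW : W = ⟨1, -1, 0, -27435984, 55320185088⟩) {N : ℕ} [NeZero N] {K : Type} [Field K] [NumberField K]
    (hKo : kolyvagin N W K) (hB : Kolyvagin1990_padicValNat_card_sha_le N W K) (hK : IsImaginaryQuadratic K)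
    (hH : SatisfiesHeegnerHypothesis N K) {P : (W.baseChange K).toAffine.Point} (hP : IsHeegnerPoint N W K P)
    (hnt : ¬ IsOfFinAddOrder P) (hI : ¬ 5 ∣ (AddSubgroup.zmultiples P).index) (hr : W.analyticRank ≤ 1)
    {q : ℚ} (hq : shaAn W = (q : ℂ)) (hv : padicValRat 5 q = 0) : BSDp W 5 :=
  bsdp_prime_of_kolyvaginIndex_of_serreCounts 5 (by norm_num) (by norm_num) 1 (-1) 0 (-27435984) 55320185088 (by decide +kernel)
    (by decide +kernel) (by decide +kernel) 13 7 7 (by norm_num) (by norm_num) (by norm_num) (by norm_num)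
    (by norm_num) (by norm_num) (by norm_num) (by norm_num) (by norm_num) (by decide +kernel) (by decide +kernel)
    (by decide +kernel) (n₁ := 18) (n₂ := 12) (n₃ := 12) (hc₁ := by decide +kernel) (hc₂ := by decide +kernel)
    (hc₃ := by decide +kernel) (by decide +kernel) (by decide +kernel) (by decide +kernel) hGZK W
    (by rw [hW]; norm_num) hKo hB hK hH hP hnt hI hr hq hv

/-- **`BSD(E,5)` for `433160h1`** (`N = 433160 = 2³·5·7²·13·17`; NON-SPLIT MULTIPLICATIVE at `5` (Kodaira `I3`, `c_5 = 1`, additive at `2`, `7`);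
`#tors = 1`, `∏c = 8`, `r_an = 1`, `#Ш_an = 1`, generator `(44, 49)`; lane residue cell `(5, X11b)` (bsdN v4u/v5u of record: `residue:X11b`, lane
tail T-KOLY); ALSO the unit's GEN 10 beyond-window DATA record in `X11b/BeyondWindowRecords58.lean` (Skinner 2016 Thm. A ∘ Stein–Wuthrich 2013
`p`-adic road, binders as displayed there) — this row is a SECOND road). `D = -1511` (1511 prime): **`m = [E(K):ℤy_K] = 16`, `5 ∤ m`**
(`ρ = 63.99…`; `L'(E,1) = 5.64037918…`, `L(E^D,1) = 0.11202052…`, `ĥ(x) = 0.73645619…`) — engine 1 (j259809) = engine 2 (j260666; EQUAL, dev. ≤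
5.2·10⁻¹⁴, checks true); twist `E^D` (j260667): `#tors·∏c·#Ш_an = 1·16·1`, prime to `5` — BSD-consistent. Witnesses mod `5` `(ℓ,#Ẽ(𝔽_ℓ))` =
`(23,25)` (`a = -1`, `a² − 4ℓ ≡ 4` square), `(3,6)` (`a = -2`, `a² − 4ℓ ≡ 2` non-square), `(3,6)` (`u ≡ 3`).
[cite: McCallumLMS1991, §1 Theorem (Kolyvagin), p. 296] [cite: Serre1972, §2.8 Prop. 19] [cite: Cremona2006, Table 1 (label 433160h1)] -/
theorem bsdp_k433160h1_5 (hGZK : rank_eq_analyticRank_of_analyticRank_le_one) (W : WeierstrassCurve ℚ)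
    (hW : W = ⟨0, 1, 0, -5896, 174705⟩) {N : ℕ} [NeZero N] {K : Type} [Field K] [NumberField K]
    (hKo : kolyvagin N W K) (hB : Kolyvagin1990_padicValNat_card_sha_le N W K) (hK : IsImaginaryQuadratic K)
    (hH : SatisfiesHeegnerHypothesis N K) {P : (W.baseChange K).toAffine.Point} (hP : IsHeegnerPoint N W K P)
    (hnt : ¬ IsOfFinAddOrder P) (hI : ¬ 5 ∣ (AddSubgroup.zmultiples P).index) (hr : W.analyticRank ≤ 1)
    {q : ℚ} (hq : shaAn W = (q : ℂ)) (hv : padicValRat 5 q = 0) : BSDp W 5 :=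
  bsdp_prime_of_kolyvaginIndex_of_serreCounts 5 (by norm_num) (by norm_num) 0 1 0 (-5896) 174705 (by decide +kernel)
    (by decide +kernel) (by decide +kernel) 23 3 3 (by norm_num) (by norm_num) (by norm_num) (by norm_num)
    (by norm_num) (by norm_num) (by norm_num) (by norm_num) (by norm_num) (by decide +kernel) (by decide +kernel)
    (by decide +kernel) (n₁ := 25) (n₂ := 6) (n₃ := 6) (hc₁ := by decide +kernel) (hc₂ := by decide +kernel)
    (hc₃ := by decide +kernel) (by decide +kernel) (by decide +kernel) (by decide +kernel) hGZK W
    (by rw [hW]; norm_num) hKo hB hK hH hP hnt hI hr hq hv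

/-- **`BSD(E,5)` for `433290x1`** (`N = 433290 = 2·3·5·11·13·101`; NON-SPLIT MULTIPLICATIVE at `5` (Kodaira `I2`, `c_5 = 2`, semistable); `#tors = 2`,
`∏c = 144`, `r_an = 1`, `#Ш_an = 1`, generator `(16, 157)`; lane residue cell `(5, X11b)` (bsdN v4u/v5u of record: `residue:X11b`, lane tail
T-JSW+T-BCS, other open cells `(3, X11b)`, `(11, X11b)`, `(13, X11b)`, `(101, X11b)`); ALSO the unit's GEN 10 beyond-window DATA record in
`X11b/BeyondWindowRecords58.lean` (Skinner 2016 Thm. A ∘ Stein–Wuthrich 2013 `p`-adic road, binders as displayed there) — this row is a SECOND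
road). `D = -5639` (5639 prime): **`m = [E(K):ℤy_K] = 144`, `5 ∤ m`** (`ρ = 5183.99…`; `L'(E,1) = 11.68391582…`, `L(E^D,1) = 2.31664098…`,
`ĥ(x) = 0.47549919…`) — engine 1 (j259809) = engine 2 (j260666; EQUAL, dev. ≤ 1.4·10⁻¹³, checks true); twist `E^D` (j260667):
`#tors·∏c·#Ш_an = 2·288·4`, prime to `5` — BSD-consistent. Witnesses mod `5` `(ℓ,#Ẽ(𝔽_ℓ))` = `(7,10)` (`a = -2`, `a² − 4ℓ ≡ 1` square), `(41,48)`
(`a = -6`, `a² − 4ℓ ≡ 2` non-square), `(43,52)` (`u ≡ 3`). FLAG `opt-code-2`: Cremona's optimality code `2` (curve 1 is one of 2 possibly optimal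
curves of its class; Manin constant `1` conditional on it); the engines' normalisation assumes the optimal curve with Manin constant `1` —
`ρ̄_{E,5}` onto forbids a `5`-isogeny in the class, so `ord₅` of the Heegner index is the same for every curve of the class and the reading stands
if the optimal curve's Manin constant is prime to `5`.
[cite: McCallumLMS1991, §1 Theorem (Kolyvagin), p. 296] [cite: Serre1972, §2.8 Prop. 19] [cite: Cremona2006, Table 1 (label 433290x1)] -/
theorem bsdp_k433290x1_5 (hGZK : rank_eq_analyticRank_of_analyticRank_le_one) (W : WeierstrassCurve ℚ)
    (hW : W = ⟨1, 0, 0, 1039, 6441⟩) {N : ℕ} [NeZero N] {K : Type} [Field K] [NumberField K]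
    (hKo : kolyvagin N W K) (hB : Kolyvagin1990_padicValNat_card_sha_le N W K) (hK : IsImaginaryQuadratic K)
    (hH : SatisfiesHeegnerHypothesis N K) {P : (W.baseChange K).toAffine.Point} (hP : IsHeegnerPoint N W K P)
    (hnt : ¬ IsOfFinAddOrder P) (hI : ¬ 5 ∣ (AddSubgroup.zmultiples P).index) (hr : W.analyticRank ≤ 1)
    {q : ℚ} (hq : shaAn W = (q : ℂ)) (hv : padicValRat 5 q = 0) : BSDp W 5 :=
  bsdp_prime_of_kolyvaginIndex_of_serreCounts 5 (by norm_num) (by norm_num) 1 0 0 1039 6441 (by decide +kernel)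
    (by decide +kernel) (by decide +kernel) 7 41 43 (by norm_num) (by norm_num) (by norm_num) (by norm_num)
    (by norm_num) (by norm_num) (by norm_num) (by norm_num) (by norm_num) (by decide +kernel) (by decide +kernel)
    (by decide +kernel) (n₁ := 10) (n₂ := 48) (n₃ := 52) (hc₁ := by decide +kernel) (hc₂ := by decide +kernel)
    (hc₃ := by decide +kernel) (by decide +kernel) (by decide +kernel) (by decide +kernel) hGZK W
    (by rw [hW]; norm_num) hKo hB hK hH hP hnt hI hr hq hv

/-- **`BSD(E,5)` for `434070ds1`** (`N = 434070 = 2·3²·5·7·13·53`; SPLIT MULTIPLICATIVE at `5` (Kodaira `I2`, `c_5 = 2`, additive at `3`); `#tors = 4`,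
`∏c = 1536`, `r_an = 1`, `#Ш_an = 1`, generator `(1077348621/1849, 35185511226256/79507)`; lane residue cell `(5, X11b)` (bsdN v4u/v5u of record:
`residue:X3`, lane tail T-BCS|open-ss, other open cells `(3, X3)`, `(7, X11b)`, `(13, X11b)`, `(53, X11b)`, `(tail, X7T)`); ALSO the unit's GEN 10
beyond-window DATA record in `X11b/BeyondWindowRecords59.lean` (Skinner 2016 Thm. A ∘ Stein–Wuthrich 2013 `p`-adic road, binders as displayed there)
— this row is a SECOND road). `D = -7271` (7271 = 11·661): **`m = [E(K):ℤy_K] = 4608`, `5 ∤ m`** (`ρ = 5308415.99…`; `L'(E,1) = 16.63940578…`,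
`L(E^D,1) = 50.84688670…`, `ĥ(x) = 16.75886827…`) — engine 1 (j260567) = engine 2 (j260960; EQUAL, dev. ≤ 7.8·10⁻¹⁴, checks true); twist `E^D`
(j260961): `#tors·∏c·#Ш_an = 2·12288·36`, prime to `5` — BSD-consistent. Witnesses mod `5` `(ℓ,#Ẽ(𝔽_ℓ))` = `(43,48)` (`a = -4`, `a² − 4ℓ ≡ 4`
square), `(17,24)` (`a = -6`, `a² − 4ℓ ≡ 3` non-square), `(17,24)` (`u ≡ 3`). FLAG `opt-code-6`: Cremona's optimality code `6` (curve 1 is one of 6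
possibly optimal curves of its class; Manin constant `1` conditional on it); the engines' normalisation assumes the optimal curve with Manin
constant `1` — `ρ̄_{E,5}` onto forbids a `5`-isogeny in the class, so `ord₅` of the Heegner index is the same for every curve of the class and the
reading stands if the optimal curve's Manin constant is prime to `5`.
[cite: McCallumLMS1991, §1 Theorem (Kolyvagin), p. 296] [cite: Serre1972, §2.8 Prop. 19] [cite: Cremona2006, Table 1 (label 434070ds1)] -/
theorem bsdp_k434070ds1_5 (hGZK : rank_eq_analyticRank_of_analyticRank_le_one) (W : WeierstrassCurve ℚ)
    (hW : W = ⟨1, -1, 1, -2833273697, -58384747790431⟩) {N : ℕ} [NeZero N] {K : Type} [Field K] [NumberField K]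
    (hKo : kolyvagin N W K) (hB : Kolyvagin1990_padicValNat_card_sha_le N W K) (hK : IsImaginaryQuadratic K)
    (hH : SatisfiesHeegnerHypothesis N K) {P : (W.baseChange K).toAffine.Point} (hP : IsHeegnerPoint N W K P)
    (hnt : ¬ IsOfFinAddOrder P) (hI : ¬ 5 ∣ (AddSubgroup.zmultiples P).index) (hr : W.analyticRank ≤ 1)
    {q : ℚ} (hq : shaAn W = (q : ℂ)) (hv : padicValRat 5 q = 0) : BSDp W 5 :=
  bsdp_prime_of_kolyvaginIndex_of_serreCounts 5 (by norm_num) (by norm_num) 1 (-1) 1 (-2833273697) (-58384747790431) (by decide +kernel)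
    (by decide +kernel) (by decide +kernel) 43 17 17 (by norm_num) (by norm_num) (by norm_num) (by norm_num)
    (by norm_num) (by norm_num) (by norm_num) (by norm_num) (by norm_num) (by decide +kernel) (by decide +kernel)
    (by decide +kernel) (n₁ := 48) (n₂ := 24) (n₃ := 24) (hc₁ := by decide +kernel) (hc₂ := by decide +kernel)
    (hc₃ := by decide +kernel) (by decide +kernel) (by decide +kernel) (by decide +kernel) hGZK W
    (by rw [hW]; norm_num) hKo hB hK hH hP hnt hI hr hq hv

/-- **`BSD(E,5)` for `436170bh1`** (`N = 436170 = 2·3·5·7·31·67`; SPLIT MULTIPLICATIVE at `5` (Kodaira `I1`, `c_5 = 1`, semistable); `#tors = 1`,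
`∏c = 12`, `r_an = 1`, `#Ш_an = 1`, generator `(-5, 23)`; lane residue cell `(5, X11b)` (bsdN v4u/v5u of record: `residue:X11b`, lane tail T-KOLY);
ALSO the unit's GEN 10 beyond-window DATA record in `X11b/BeyondWindowRecords59.lean` (Skinner 2016 Thm. A ∘ Stein–Wuthrich 2013 `p`-adic road,
binders as displayed there) — this row is a SECOND road). `D = -1391` (1391 = 13·107): **`m = [E(K):ℤy_K] = 72`, `5 ∤ m`** (`ρ = 1296.00…`;
`L'(E,1) = 13.84030776…`, `L(E^D,1) = 4.51920090…`, `ĥ(x) = 0.77194050…`) — engine 1 (j259809) = engine 2 (j260660; EQUAL, dev. ≤ 5.3·10⁻¹⁴, checks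
true); twist `E^D` (j260667): `#tors·∏c·#Ш_an = 1·12·9`, prime to `5` — BSD-consistent. Witnesses mod `5` `(ℓ,#Ẽ(𝔽_ℓ))` = `(17,11)` (`a = 7`,
`a² − 4ℓ ≡ 1` square), `(41,38)` (`a = 4`, `a² − 4ℓ ≡ 2` non-square), `(83,71)` (`u ≡ 3`).
[cite: McCallumLMS1991, §1 Theorem (Kolyvagin), p. 296] [cite: Serre1972, §2.8 Prop. 19] [cite: Cremona2006, Table 1 (label 436170bh1)] -/
theorem bsdp_k436170bh1_5 (hGZK : rank_eq_analyticRank_of_analyticRank_le_one) (W : WeierstrassCurve ℚ)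
    (hW : W = ⟨1, 1, 1, -140, -163⟩) {N : ℕ} [NeZero N] {K : Type} [Field K] [NumberField K]
    (hKo : kolyvagin N W K) (hB : Kolyvagin1990_padicValNat_card_sha_le N W K) (hK : IsImaginaryQuadratic K)
    (hH : SatisfiesHeegnerHypothesis N K) {P : (W.baseChange K).toAffine.Point} (hP : IsHeegnerPoint N W K P)
    (hnt : ¬ IsOfFinAddOrder P) (hI : ¬ 5 ∣ (AddSubgroup.zmultiples P).index) (hr : W.analyticRank ≤ 1)
    {q : ℚ} (hq : shaAn W = (q : ℂ)) (hv : padicValRat 5 q = 0) : BSDp W 5 :=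
  bsdp_prime_of_kolyvaginIndex_of_serreCounts 5 (by norm_num) (by norm_num) 1 1 1 (-140) (-163) (by decide +kernel)
    (by decide +kernel) (by decide +kernel) 17 41 83 (by norm_num) (by norm_num) (by norm_num) (by norm_num)
    (by norm_num) (by norm_num) (by norm_num) (by norm_num) (by norm_num) (by decide +kernel) (by decide +kernel)
    (by decide +kernel) (n₁ := 11) (n₂ := 38) (n₃ := 71) (hc₁ := by decide +kernel) (hc₂ := by decide +kernel)
    (hc₃ := by decide +kernel) (by decide +kernel) (by decide +kernel) (by decide +kernel) hGZK W
    (by rw [hW]; norm_num) hKo hB hK hH hP hnt hI hr hq hv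

/-- **`BSD(E,5)` for `436590ea1`** (`N = 436590 = 2·3⁴·5·7²·11`; NON-SPLIT MULTIPLICATIVE at `5` (Kodaira `I1`, `c_5 = 1`, additive at `3`, `7`);
`#tors = 1`, `∏c = 16`, `r_an = 1`, `#Ш_an = 1`, generator `(697, 32391)`; lane residue cell `(5, X11b)` (bsdN v4u/v5u of record: `residue:X11b`,
lane tail T-KOLY); ALSO the unit's GEN 10 beyond-window DATA record in `X11b/BeyondWindowRecords59.lean` (Skinner 2016 Thm. A ∘ Stein–Wuthrich 2013
`p`-adic road, binders as displayed there) — this row is a SECOND road). `D = -1319` (1319 prime): **`m = [E(K):ℤy_K] = 64`, `5 ∤ m`**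
(`ρ = 1024.00…`; `L'(E,1) = 13.65793093…`, `L(E^D,1) = 0.18584273…`, `ĥ(x) = 5.76221401…`) — engine 1 (j259809) = engine 2 (j260660; EQUAL, dev. ≤
2.7·10⁻¹³, checks true); twist `E^D` (j260667): `#tors·∏c·#Ш_an = 1·32·4`, prime to `5` — BSD-consistent. Witnesses mod `5` `(ℓ,#Ẽ(𝔽_ℓ))` =
`(23,18)` (`a = 6`, `a² − 4ℓ ≡ 4` square), `(13,11)` (`a = 3`, `a² − 4ℓ ≡ 2` non-square), `(13,11)` (`u ≡ 3`).
[cite: McCallumLMS1991, §1 Theorem (Kolyvagin), p. 296] [cite: Serre1972, §2.8 Prop. 19] [cite: Cremona2006, Table 1 (label 436590ea1)] -/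
theorem bsdp_k436590ea1_5 (hGZK : rank_eq_analyticRank_of_analyticRank_le_one) (W : WeierstrassCurve ℚ)
    (hW : W = ⟨1, -1, 1, -4052138, 3558002921⟩) {N : ℕ} [NeZero N] {K : Type} [Field K] [NumberField K]
    (hKo : kolyvagin N W K) (hB : Kolyvagin1990_padicValNat_card_sha_le N W K) (hK : IsImaginaryQuadratic K)
    (hH : SatisfiesHeegnerHypothesis N K) {P : (W.baseChange K).toAffine.Point} (hP : IsHeegnerPoint N W K P)
    (hnt : ¬ IsOfFinAddOrder P) (hI : ¬ 5 ∣ (AddSubgroup.zmultiples P).index) (hr : W.analyticRank ≤ 1)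
    {q : ℚ} (hq : shaAn W = (q : ℂ)) (hv : padicValRat 5 q = 0) : BSDp W 5 :=
  bsdp_prime_of_kolyvaginIndex_of_serreCounts 5 (by norm_num) (by norm_num) 1 (-1) 1 (-4052138) 3558002921 (by decide +kernel)
    (by decide +kernel) (by decide +kernel) 23 13 13 (by norm_num) (by norm_num) (by norm_num) (by norm_num)
    (by norm_num) (by norm_num) (by norm_num) (by norm_num) (by norm_num) (by decide +kernel) (by decide +kernel)
    (by decide +kernel) (n₁ := 18) (n₂ := 11) (n₃ := 11) (hc₁ := by decide +kernel) (hc₂ := by decide +kernel)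
    (hc₃ := by decide +kernel) (by decide +kernel) (by decide +kernel) (by decide +kernel) hGZK W
    (by rw [hW]; norm_num) hKo hB hK hH hP hnt hI hr hq hv

/-- **`BSD(E,5)` for `436590ex1`** (`N = 436590 = 2·3⁴·5·7²·11`; NON-SPLIT MULTIPLICATIVE at `5` (Kodaira `I2`, `c_5 = 2`, additive at `3`, `7`);
`#tors = 1`, `∏c = 12`, `r_an = 1`, `#Ш_an = 1`, generator `(687/4, -201/8)`; lane residue cell `(5, X11b)` (bsdN v4u/v5u of record: `residue:X11b`,
lane tail T-KOLY); ALSO the unit's GEN 10 beyond-window DATA record in `X11b/BeyondWindowRecords59.lean` (Skinner 2016 Thm. A ∘ Stein–Wuthrich 2013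
`p`-adic road, binders as displayed there) — this row is a SECOND road). `D = -1559` (1559 prime): **`m = [E(K):ℤy_K] = 48`, `5 ∤ m`**
(`ρ = 575.99…`; `L'(E,1) = 14.20020444…`, `L(E^D,1) = 0.33956836…`, `ĥ(x) = 1.56512245…`) — engine 1 (j259809) = engine 2 (j260660; EQUAL, dev. ≤
3.8·10⁻¹⁴, checks true); twist `E^D` (j260667): `#tors·∏c·#Ш_an = 1·12·4`, prime to `5` — BSD-consistent. Witnesses mod `5` `(ℓ,#Ẽ(𝔽_ℓ))` =
`(13,10)` (`a = 4`, `a² − 4ℓ ≡ 4` square), `(19,18)` (`a = 2`, `a² − 4ℓ ≡ 3` non-square), `(37,42)` (`u ≡ 3`).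
[cite: McCallumLMS1991, §1 Theorem (Kolyvagin), p. 296] [cite: Serre1972, §2.8 Prop. 19] [cite: Cremona2006, Table 1 (label 436590ex1)] -/
theorem bsdp_k436590ex1_5 (hGZK : rank_eq_analyticRank_of_analyticRank_le_one) (W : WeierstrassCurve ℚ)
    (hW : W = ⟨1, -1, 1, -85343, 9617157⟩) {N : ℕ} [NeZero N] {K : Type} [Field K] [NumberField K]
    (hKo : kolyvagin N W K) (hB : Kolyvagin1990_padicValNat_card_sha_le N W K) (hK : IsImaginaryQuadratic K)
    (hH : SatisfiesHeegnerHypothesis N K) {P : (W.baseChange K).toAffine.Point} (hP : IsHeegnerPoint N W K P)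
    (hnt : ¬ IsOfFinAddOrder P) (hI : ¬ 5 ∣ (AddSubgroup.zmultiples P).index) (hr : W.analyticRank ≤ 1)
    {q : ℚ} (hq : shaAn W = (q : ℂ)) (hv : padicValRat 5 q = 0) : BSDp W 5 :=
  bsdp_prime_of_kolyvaginIndex_of_serreCounts 5 (by norm_num) (by norm_num) 1 (-1) 1 (-85343) 9617157 (by decide +kernel)
    (by decide +kernel) (by decide +kernel) 13 19 37 (by norm_num) (by norm_num) (by norm_num) (by norm_num)
    (by norm_num) (by norm_num) (by norm_num) (by norm_num) (by norm_num) (by decide +kernel) (by decide +kernel)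
    (by decide +kernel) (n₁ := 10) (n₂ := 18) (n₃ := 42) (hc₁ := by decide +kernel) (hc₂ := by decide +kernel)
    (hc₃ := by decide +kernel) (by decide +kernel) (by decide +kernel) (by decide +kernel) hGZK W
    (by rw [hW]; norm_num) hKo hB hK hH hP hnt hI hr hq hv

/-- **`BSD(E,5)` for `438960bd1`** (`N = 438960 = 2⁴·3·5·31·59`; NON-SPLIT MULTIPLICATIVE at `5` (Kodaira `I3`, `c_5 = 1`, additive at `2`);
`#tors = 1`, `∏c = 1`, `r_an = 1`, `#Ш_an = 1`, generator `(6, 6)`; lane residue cell `(5, X11b)` (bsdN v4u/v5u of record: `residue:X11b,X7`, lane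
tail T-KOLY, other open cells `(719, X7)`); ALSO the unit's GEN 10 beyond-window DATA record in `X11b/BeyondWindowRecords59.lean` (Skinner 2016 Thm.
A ∘ Stein–Wuthrich 2013 `p`-adic road, binders as displayed there) — this row is a SECOND road). `D = -1391` (1391 = 13·107):
**`m = [E(K):ℤy_K] = 18`, `5 ∤ m`** (`ρ = 81.00…`; `L'(E,1) = 4.32427662…`, `L(E^D,1) = 3.25039146…`, `ĥ(x) = 1.94688035…`) — engine 1 (j259809) =
engine 2 (j260662; EQUAL, dev. ≤ 7.5·10⁻¹⁴, checks true); twist `E^D` (j260667): `#tors·∏c·#Ш_an = 1·2·81`, prime to `5` — BSD-consistent. Witnesses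
mod `5` `(ℓ,#Ẽ(𝔽_ℓ))` = `(7,10)` (`a = -2`, `a² − 4ℓ ≡ 1` square), `(13,16)` (`a = -2`, `a² − 4ℓ ≡ 2` non-square), `(13,16)` (`u ≡ 3`).
[cite: McCallumLMS1991, §1 Theorem (Kolyvagin), p. 296] [cite: Serre1972, §2.8 Prop. 19] [cite: Cremona2006, Table 1 (label 438960bd1)] -/
theorem bsdp_k438960bd1_5 (hGZK : rank_eq_analyticRank_of_analyticRank_le_one) (W : WeierstrassCurve ℚ)
    (hW : W = ⟨0, 1, 0, -101, 390⟩) {N : ℕ} [NeZero N] {K : Type} [Field K] [NumberField K]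
    (hKo : kolyvagin N W K) (hB : Kolyvagin1990_padicValNat_card_sha_le N W K) (hK : IsImaginaryQuadratic K)
    (hH : SatisfiesHeegnerHypothesis N K) {P : (W.baseChange K).toAffine.Point} (hP : IsHeegnerPoint N W K P)
    (hnt : ¬ IsOfFinAddOrder P) (hI : ¬ 5 ∣ (AddSubgroup.zmultiples P).index) (hr : W.analyticRank ≤ 1)
    {q : ℚ} (hq : shaAn W = (q : ℂ)) (hv : padicValRat 5 q = 0) : BSDp W 5 :=
  bsdp_prime_of_kolyvaginIndex_of_serreCounts 5 (by norm_num) (by norm_num) 0 1 0 (-101) 390 (by decide +kernel)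
    (by decide +kernel) (by decide +kernel) 7 13 13 (by norm_num) (by norm_num) (by norm_num) (by norm_num)
    (by norm_num) (by norm_num) (by norm_num) (by norm_num) (by norm_num) (by decide +kernel) (by decide +kernel)
    (by decide +kernel) (n₁ := 10) (n₂ := 16) (n₃ := 16) (hc₁ := by decide +kernel) (hc₂ := by decide +kernel)
    (hc₃ := by decide +kernel) (by decide +kernel) (by decide +kernel) (by decide +kernel) hGZK W
    (by rw [hW]; norm_num) hKo hB hK hH hP hnt hI hr hq hv

end Summit.BirchSwinnertonDyer.Rank1Residual.X11b

end
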